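/-
lean1 cell, LEAN TYPING SEAT 1 (unit `b2b-lace-lean1-g40`): KU-SEP SWAP TABLES Rev4 at `d := 10` — the `𝒳` / `Q`-region slot tables of
`KUSepD10` (Rev1) with the `U` REGION tables swapped: `uS2X` / `uS3X` = `TUSupD10.uS2` / `uS3` with the six slots improved by the landed
region-sup theorems of `USupKUSepD10` replaced by their literals (fallback: the tree table, by name), the direct `T`-slot tables re-assembled
on them, and the six `𝒳` / cone / `Q` slot theorems re-wired.  Additive and side by side with Rev1–Rev3: no module is modified, no table of
record is touched; every override is a landed theorem read by name; no numeral of record, no tuple, no certificate, no dimension sentence.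
-/
import Literature.Probability.FitznerVanDerHofstad2017.SrwUSupKUSepD10
import Literature.Probability.FitznerVanDerHofstad2017.SrwKTUTablesD10KUSep
import HarnessLib

/-!
# KU-SEP swap tables Rev4 at `d := 10`: the `𝒳` / `Q`-region `U` tables with the landed region-sup literals (what-if lane)

[NoBLE] = Fitzner–van der Hofstad, *Generalized approach to the non-backtracking lace expansion*, PTRF **169** (2017) 1041–1119,
arXiv:1506.07969: (3.36)–(3.38) p. 1071 (the SRW integrals `K_{n,l}`, `U_{n,l}`, `T_{n,l}`), §5.2 (5.9)–(5.16) pp. 1091–1092 (their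
numerical bounds), §3.3.5 (3.58)–(3.64), (3.87) pp. 1074–1079 (the cell bound of `f₃` reading the tables), §5.1 p. 1093 (the regions).
[FvdH17] = Fitzner–van der Hofstad, *Mean-field behavior for nearest-neighbor percolation in `d > 10`*, EJP **22** (2017) no. 43,
arXiv:1506.07977, §2.5 (entrywise numerical verification from rational data; the Mathematica notebooks are the primary of the `d = 11` proof).

WHAT-IF LANE at the SRW-table parameter `d := 10`: every statement below is an unconditional real-analysis inequality about the integrals
`srwU 10 …`, `srwTS 10 …` and the majorant `boundHD75Phi (srwTrueAlt 10 …)`, or a definition of a rational table; nothing is asserted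
about percolation in any dimension and no table of record is modified.

* §1 `uS2X n l`, `uS3X n l` — the region sup tables `TUSupD10.uS2` (`Σ_μ |x_μ| ≥ 2`), `TUSupD10.uS3` (`≥ 3`) with the slots
  `(3,1), (3,2), (4,1), (4,2)` resp. `(3,0), (4,0)` replaced by the literals of `USupKUSepD10.srwU_{zero,one,two}_le_of_{two,three}_le_d10_n{3,4}`
  (axis cells of `UZeroCellD10` / `UTwoCellD10` + (5.9) tails and cone nodes); soundness `srwU_le_uS2X`, `srwU_le_uS3X` in the exact shape
  of `TUSupD10.srwU_le_uS2`, `srwU_le_uS3`; real heads `uXX`, `uQX` (twins of `CellSupD10.uX`, `uQ`) with `srwU_calX_leX`, `srwU_le_uQX_on`.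
* §2 the `ℚ` direct-slot tables `tXDQX4 α m l := min (KUSepD10.tS2X m l) (KUSepD10.kS2X m (l+1) + (2/α)·uS2X (m+1) l)` and `tQDQX4`
  (on `kS3X`, `uS3X`), their real heads `tXDX4`, `tQDX4` and the region soundness theorems `srwTS_calX_le_tXDX4`, `srwTS_le_tQDX4_on`
  (the `K` tables and the `T^{(5.11)}`-rule tables are Rev1's `KUSepD10.kS2X/kS3X/tS2X/tS3X`, by name).
* §3 the `h2phi` cell theorems over `𝒳` and over `C ⊆ Q10` wired to the swapped tables, and the closing rules
  `boundHD75Phi_cell{XDX4,QDX4}_le_of_ratLe`.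
* §4 the six slot theorems `slotXDX4_{zero,one}_le_phi`, `slotConeDX4_{zero,one}_le_phi`, `slotQDX4_{zero,one}_le_phi` — twins of
  `KUSepD10.slotXDX_*`, `slotConeDX_*`, `slotQDX_*` with conclusions VERBATIM the same and the numeral hypothesis `hnum` reading the swapped
  tables: a consumer re-decides an `𝒳` / `Q` row by renaming `tXDQX ↦ KUSepD10R4.tXDQX4`, `uS2 ↦ uS2X`, `tQDQX ↦ tQDQX4`, `uS3 ↦ uS3X`
  (`kS2X`, `kS3X` unchanged) and the slot theorem name.  The node slot theorems are Rev3's / Rev2's (`KUSepD10R3.slotNDX_*`), untouched.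
-/

noncomputable section

namespace Literature.Probability.FitznerVanDerHofstad2017

namespace KUSepD10R4

open Literature.Barriers.CriticalPhenomena Literature.Probability.LatticeModels
open F3Bounds F3Bounds.CellNumQ KTUD10 KSupD10 TUSupD10 CellSupD10 CellImD10 SlotD10 SlotD10Phi KUSepD10 USupKUSepD10
open scoped BigOperators

/-! ### §1  The swapped `U` region tables and their soundness -/

/-- **Swapped region `U` table over `Σ_μ |x_μ| ≥ 2`**: `uS2 n l` with the slots `(3,1), (3,2), (4,1), (4,2)` replaced by the landed
region-sup literals of `USupKUSepD10`. [cite: FitznerVanDerHofstad2016NoBLE, (3.38) p. 1071; §5.2 (5.9), (5.12)–(5.16) pp. 1091–1092; §5.1 p. 1093] -/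
def uS2X (n l : ℕ) : ℚ :=
  match n, l with
  | 3, 1 => 49588 / 10000000
  | 3, 2 => 22779 / 10000000
  | 4, 1 => 96101 / 10000000
  | 4, 2 => 51700 / 10000000
  | _, _ => uS2 n l

/-- **Soundness of `uS2X`**: `U_{n,l}(x; 10) ≤ uS2X n l` whenever `Σ_μ |x_μ| ≥ 2` (`1 ≤ n ≤ 4`, `l ≤ 22`; fallback `TUSupD10.srwU_le_uS2`). [cite: FitznerVanDerHofstad2016NoBLE, (3.38) p. 1071; §5.2 (5.9), (5.12)–(5.16) pp. 1091–1092; §5.1 p. 1093] -/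
theorem srwU_le_uS2X {n : ℕ} (hn1 : 1 ≤ n) (hn : n ≤ 4) {l : ℕ} (hl : l ≤ 22)
    (x : Fin 10 → ℤ) (hx : 2 ≤ ∑ μ, |x μ|) : srwU 10 n l x ≤ ((uS2X n l : ℚ) : ℝ) := by
  unfold uS2X
  split
  · exact USupKUSepD10.srwU_one_le_of_two_le_d10_n3 x hx
  · exact USupKUSepD10.srwU_two_le_of_two_le_d10_n3 x hx
  · exact USupKUSepD10.srwU_one_le_of_two_le_d10_n4 x hx
  · exact USupKUSepD10.srwU_two_le_of_two_le_d10_n4 x hx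
  · exact srwU_le_uS2 hn1 hn hl x hx

/-- **Swapped region `U` table over `Q = {Σ_μ |x_μ| ≥ 3}`**: `uS3 n l` with the slots `(3,0), (4,0)` replaced by the landed region-sup
literals of `USupKUSepD10`. [cite: FitznerVanDerHofstad2016NoBLE, (3.38) p. 1071; §5.2 (5.9), (5.12)–(5.16) pp. 1091–1092; §5.1 p. 1093] -/
def uS3X (n l : ℕ) : ℚ :=
  match n, l with
  | 3, 0 => 168042 / 10000000
  | 4, 0 => 244540 / 10000000
  | _, _ => uS3 n l

/-- **Soundness of `uS3X`**: `U_{n,l}(x; 10) ≤ uS3X n l` whenever `Σ_μ |x_μ| ≥ 3` (`1 ≤ n ≤ 4`, `l ≤ 22`; fallback `TUSupD10.srwU_le_uS3`). [cite: FitznerVanDerHofstad2016NoBLE, (3.38) p. 1071; §5.2 (5.9), (5.12)–(5.16) pp. 1091–1092; §5.1 p. 1093] -/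
theorem srwU_le_uS3X {n : ℕ} (hn1 : 1 ≤ n) (hn : n ≤ 4) {l : ℕ} (hl : l ≤ 22)
    (x : Fin 10 → ℤ) (hx : 3 ≤ ∑ μ, |x μ|) : srwU 10 n l x ≤ ((uS3X n l : ℚ) : ℝ) := by
  unfold uS3X
  split
  · exact USupKUSepD10.srwU_zero_le_of_three_le_d10_n3 x hx
  · exact USupKUSepD10.srwU_zero_le_of_three_le_d10_n4 x hx
  · exact srwU_le_uS3 hn1 hn hl x hx

/-- Real head of the swapped `U` table over `𝒳` (twin of `CellSupD10.uX`). [cite: FitznerVanDerHofstad2016NoBLE, (3.38) p. 1071; §5.2 (5.9), (5.12)–(5.16) pp. 1091–1092; §5.1 p. 1093] -/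
def uXX (n l : ℕ) : ℝ := ((uS2X n l : ℚ) : ℝ)

/-- Real head of the swapped `U` table over `Q` (twin of `CellSupD10.uQ`). [cite: FitznerVanDerHofstad2016NoBLE, (3.38) p. 1071; §5.2 (5.9), (5.12)–(5.16) pp. 1091–1092; §5.1 p. 1093] -/
def uQX (n l : ℕ) : ℝ := ((uS3X n l : ℚ) : ℝ)

/-- `∀ x ∈ 𝒳, U_{n,l}(x) ≤ uXX n l` (`1 ≤ n ≤ 4`, `l ≤ 22`) — twin of `CellSupD10.srwU_calX_le`. [cite: FitznerVanDerHofstad2016NoBLE, (3.38) p. 1071; §5.2 (5.9), (5.12)–(5.16) pp. 1091–1092; §5.1 p. 1093] [cite: FitznerVanDerHofstad2017, (2.23) (the set `𝒳`)] -/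
theorem srwU_calX_leX {n : ℕ} (hn1 : 1 ≤ n) (hn : n ≤ 4) {l : ℕ} (hl : l ≤ 22) :
    ∀ x ∈ calX 10, srwU 10 n l x ≤ uXX n l :=
  fun x hx => srwU_le_uS2X hn1 hn hl x (two_le_sum_abs_of_mem_calX x hx)

/-- `∀ x ∈ C, U_{n,l}(x) ≤ uQX n l` for every `C ⊆ Q10` — twin of `CellSupD10.srwU_le_uQ_on`. [cite: FitznerVanDerHofstad2016NoBLE, (3.38) p. 1071; §5.2 (5.9), (5.12)–(5.16) pp. 1091–1092; §5.1 p. 1093] -/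
theorem srwU_le_uQX_on {C : Set (Fin 10 → ℤ)} (hC : C ⊆ Q10) {n : ℕ} (hn1 : 1 ≤ n) (hn : n ≤ 4) {l : ℕ} (hl : l ≤ 22) :
    ∀ x ∈ C, srwU 10 n l x ≤ uQX n l :=
  fun x hx => srwU_le_uS3X hn1 hn hl x (hC hx)

/-! ### §2  The direct-slot tables over `ℚ` on the swapped `U` tables, the real heads, the region soundness theorems -/

/-- `ℚ` direct `T`-slot table over `𝒳`, swapped: `min (tS2X m l) (kS2X m (l+1) + (2/α)·uS2X (m+1) l)` — Rev4 twin of `KUSepD10.tXDQX` / `SlotD10.tXDQ`. [cite: FitznerVanDerHofstad2016NoBLE, §5.2 (5.9), (5.11), (5.15) p. 1092; §3.3.5 (3.87) p. 1079] -/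
def tXDQX4 (α : ℚ) (m l : ℕ) : ℚ := min (tS2X m l) (kS2X m (l + 1) + 2 / α * uS2X (m + 1) l)

/-- `ℚ` direct `T`-slot table over `Q` and its cones, swapped: `min (tS3X m l) (kS3X m (l+1) + (2/α)·uS3X (m+1) l)` — Rev4 twin of `KUSepD10.tQDQX` / `SlotD10.tQDQ`. [cite: FitznerVanDerHofstad2016NoBLE, §5.2 (5.9), (5.11), (5.15) p. 1092; §3.3.5 (3.87) p. 1079] -/
def tQDQX4 (α : ℚ) (m l : ℕ) : ℚ := min (tS3X m l) (kS3X m (l + 1) + 2 / α * uS3X (m + 1) l)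

/-- Real head of the swapped direct `T`-slot table over `𝒳` (twin of `CellSupD10.tXD` at rational `α`). [cite: FitznerVanDerHofstad2016NoBLE, §5.2 (5.9), (5.11), (5.15) p. 1092; §3.3.5 (3.87) p. 1079] -/
def tXDX4 (α : ℚ) (m l : ℕ) : ℝ := ((tXDQX4 α m l : ℚ) : ℝ)

/-- Real head of the swapped direct `T`-slot table over `Q` (twin of `CellSupD10.tQD` at rational `α`). [cite: FitznerVanDerHofstad2016NoBLE, §5.2 (5.9), (5.11), (5.15) p. 1092; §3.3.5 (3.87) p. 1079] -/
def tQDX4 (α : ℚ) (m l : ℕ) : ℝ := ((tQDQX4 α m l : ℚ) : ℝ)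

/-- `∀ x ∈ 𝒳, srwTS 10 α m l x ≤ tXDX4 α m l` (`1 ≤ α`, `1 ≤ m ≤ 3`, `l ≤ 21`) — twin of `CellSupD10.srwTS_calX_le_tXD`. [cite: FitznerVanDerHofstad2016NoBLE, §5.2 (5.9), (5.11), (5.15) p. 1092; §3.3.5 (3.87) p. 1079] [cite: FitznerVanDerHofstad2017, (2.23)] -/
theorem srwTS_calX_le_tXDX4 {α : ℚ} (hα : 1 ≤ α) {m : ℕ} (hm1 : 1 ≤ m) (hm : m ≤ 3) {l : ℕ} (hl : l ≤ 21) :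
    ∀ x ∈ calX 10, srwTS 10 (α : ℝ) m l x ≤ tXDX4 α m l := by
  have hαR : (1 : ℝ) ≤ (α : ℝ) := by exact_mod_cast hα
  intro x hx
  have h2 := two_le_sum_abs_of_mem_calX x hx
  simp only [tXDX4, tXDQX4, Rat.cast_min, Rat.cast_add, Rat.cast_mul, Rat.cast_div, Rat.cast_ofNat]
  exact le_min (srwTS_le_tS2X_of_two_le hαR hm1 hm hl x h2)
    (srwTS_le_direct (by linarith) x (srwK_le_kS2X hm1 (by omega) (by omega) x h2)
      (srwU_le_uS2X (by omega) (by omega) (by omega) x h2))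

/-- `∀ x ∈ C, srwTS 10 α m l x ≤ tQDX4 α m l` for every `C ⊆ Q10` (`1 ≤ α`, `1 ≤ m ≤ 3`, `l ≤ 21`) — twin of `CellSupD10.srwTS_le_tQD_on`. [cite: FitznerVanDerHofstad2016NoBLE, §5.2 (5.9), (5.11), (5.15) p. 1092; §3.3.5 (3.87) p. 1079] [cite: FitznerVanDerHofstad2016NoBLE, §5.1 p. 1093] -/
theorem srwTS_le_tQDX4_on {C : Set (Fin 10 → ℤ)} (hC : C ⊆ Q10) {α : ℚ} (hα : 1 ≤ α) {m : ℕ} (hm1 : 1 ≤ m) (hm : m ≤ 3)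
    {l : ℕ} (hl : l ≤ 21) : ∀ x ∈ C, srwTS 10 (α : ℝ) m l x ≤ tQDX4 α m l := by
  have hαR : (1 : ℝ) ≤ (α : ℝ) := by exact_mod_cast hα
  intro x hx
  have h3 : 3 ≤ ∑ μ, |x μ| := hC hx
  simp only [tQDX4, tQDQX4, Rat.cast_min, Rat.cast_add, Rat.cast_mul, Rat.cast_div, Rat.cast_ofNat]
  exact le_min (srwTS_le_tS3X_of_three_le hαR hm1 hm hl x h3)
    (srwTS_le_direct (by linarith) x (srwK_le_kS3X hm1 (by omega) (by omega) x h3)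
      (srwU_le_uS3X (by omega) (by omega) (by omega) x h3))

/-! ### §3  The `h2phi` cell theorems over `𝒳` / `C ⊆ Q10` wired to the swapped tables, and the closing rules -/

section Wired

variable {α : ℚ} {afmax : ℝ}

/-- **Cell `(0,l)` over `𝒳`, `boundHD75Phi`, swapped direct `T` slot `tXDX4 α`** (`l ≤ 20`) — twin of `SlotD10Phi.f3cellD10D_zero_calX_le_phi`
(`U` over `𝒳` unchanged: `CellSupD10.srwU_calX_leX`). [cite: FitznerVanDerHofstad2016NoBLE, §3.3.5 (3.87) p. 1079; (3.58)–(3.64) p. 1076; §5.2 (5.9), (5.15) p. 1092] [cite: FitznerVanDerHofstad2017, §2.5] -/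
theorem f3cellD10DX4_zero_calX_le_phi (hα : 1 ≤ α) (hᾱ : 1 ≤ afmax) {a : Args} (ha : a.WF)
    {IMc : ℤ → ℕ → ℝ} {l : ℕ} (hl : l ≤ 20) {b : ℝ}
    (hE0 : CellDomAlt 10 (α : ℝ) afmax 0 l (IMc 0 l)) (hE0' : CellDomAlt 10 (α : ℝ) afmax 0 (l + 1) (IMc 0 (l + 1)))
    (hN1 : srwINode2 10 1 (l + 1) + srwIShift2Node2 10 2 l / (2 * ((10 : ℕ) : ℝ) ^ 2 * (α : ℝ)) ≤ IMc (-1) l)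
    (hN2 : srwINode2 10 2 l ≤ ((10 : ℕ) : ℝ) * (α : ℝ) * IMc (-1) l)
    (hnum : boundHD75Phi (Tables.cell IMc (tXDX4 α) uXX kXX : Tables (Fin 10 → ℤ)) 0 l 0 a ≤ b) :
    ∀ x ∈ calX 10, boundHD75Phi (srwTrueAlt 10 (α : ℝ) afmax) 0 l x a ≤ b :=
  have hαR : (1 : ℝ) ≤ (α : ℝ) := by exact_mod_cast hα
  boundHD75Phi_srwTrueAlt_zero_cell_le (by norm_num) (by linarith) hᾱ ha hE0 hE0' hN1 hN2
    (srwTS_calX_le_tXDX4 hα (by norm_num) (by norm_num) (by omega)) (srwTS_calX_le_tXDX4 hα (by norm_num) (by norm_num) (by omega))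
    (srwTS_calX_le_tXDX4 hα (by norm_num) (by norm_num) (by omega))
    (srwU_calX_leX (by norm_num) (by norm_num) (by omega)) (srwU_calX_leX (by norm_num) (by norm_num) (by omega))
    (srwK_calX_leX (by norm_num) (by norm_num) (by omega)) (srwK_calX_leX (by norm_num) (by norm_num) (by omega)) hnum

/-- **Cells `(1,l)` over `𝒳`, `boundHD75Phi`, swapped direct `T` slot `tXDX4 α`** (`l ≤ 20`) — twin of `SlotD10Phi.f3cellD10D_one_calX_le_phi`. [cite: FitznerVanDerHofstad2016NoBLE, §3.3.5 (3.87) p. 1079; (3.58)–(3.64) p. 1076; §5.2 (5.9), (5.15) p. 1092] [cite: FitznerVanDerHofstad2017, §2.5] -/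
theorem f3cellD10DX4_one_calX_le_phi (hα : 1 ≤ α) (hᾱ : 1 ≤ afmax) {a : Args} (ha : a.WF)
    {IMc : ℤ → ℕ → ℝ} {l : ℕ} (hl : l ≤ 20) {b : ℝ}
    (hE1 : CellDomAlt 10 (α : ℝ) afmax 1 l (IMc 1 l)) (hE0 : CellDomAlt 10 (α : ℝ) afmax 0 l (IMc 0 l))
    (hE1' : CellDomAlt 10 (α : ℝ) afmax 1 (l + 1) (IMc 1 (l + 1))) (hE0' : CellDomAlt 10 (α : ℝ) afmax 0 (l + 1) (IMc 0 (l + 1)))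
    (hE1'' : CellDomAlt 10 (α : ℝ) afmax 1 (l + 2) (IMc 1 (l + 2)))
    (hnum : boundHD75Phi (Tables.cell IMc (tXDX4 α) uXX kXX : Tables (Fin 10 → ℤ)) 1 l 0 a ≤ b) :
    ∀ x ∈ calX 10, boundHD75Phi (srwTrueAlt 10 (α : ℝ) afmax) 1 l x a ≤ b :=
  have hαR : (1 : ℝ) ≤ (α : ℝ) := by exact_mod_cast hα
  boundHD75Phi_srwTrueAlt_one_cell_le (by norm_num) (by linarith) hᾱ ha hE1 hE0 hE1' hE0' hE1''
    (srwTS_calX_le_tXDX4 hα (by norm_num) (by norm_num) (by omega)) (srwTS_calX_le_tXDX4 hα (by norm_num) (by norm_num) (by omega))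
    (srwTS_calX_le_tXDX4 hα (by norm_num) (by norm_num) (by omega))
    (srwU_calX_leX (by norm_num) (by norm_num) (by omega)) (srwU_calX_leX (by norm_num) (by norm_num) (by omega))
    (srwK_calX_leX (by norm_num) (by norm_num) (by omega)) (srwK_calX_leX (by norm_num) (by norm_num) (by omega)) hnum

/-- **Cell `(0,l)` over a set `C ⊆ Q10`, `boundHD75Phi`, swapped direct `T` slot `tQDX4 α`** (`l ≤ 20`) — twin of `SlotD10Phi.f3cellD10D_zero_on_le_phi`
(`U` over `Q` unchanged: `CellSupD10.srwU_le_uQX_on`). [cite: FitznerVanDerHofstad2016NoBLE, §3.3.5 (3.87) p. 1079; §5.1 p. 1093; (3.58)–(3.64) p. 1076; §5.2 (5.9), (5.15) p. 1092] [cite: FitznerVanDerHofstad2017, §2.5] -/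
theorem f3cellD10DX4_zero_on_le_phi {C : Set (Fin 10 → ℤ)} (hC : C ⊆ Q10) (hα : 1 ≤ α) (hᾱ : 1 ≤ afmax) {a : Args} (ha : a.WF)
    {IMc : ℤ → ℕ → ℝ} {l : ℕ} (hl : l ≤ 20) {b : ℝ}
    (hE0 : OnDomAlt 10 (α : ℝ) afmax C 0 l (IMc 0 l)) (hE0' : OnDomAlt 10 (α : ℝ) afmax C 0 (l + 1) (IMc 0 (l + 1)))
    (hN1 : ∀ x ∈ C, srwI 10 1 (l + 1) x + srwIShift2 10 2 l x / (2 * ((10 : ℕ) : ℝ) ^ 2 * (α : ℝ)) ≤ IMc (-1) l)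
    (hN2 : ∀ x ∈ C, srwI 10 2 l x ≤ ((10 : ℕ) : ℝ) * (α : ℝ) * IMc (-1) l)
    (hnum : boundHD75Phi (Tables.cell IMc (tQDX4 α) uQX kQX : Tables (Fin 10 → ℤ)) 0 l 0 a ≤ b) :
    ∀ x ∈ C, boundHD75Phi (srwTrueAlt 10 (α : ℝ) afmax) 0 l x a ≤ b :=
  have hαR : (1 : ℝ) ≤ (α : ℝ) := by exact_mod_cast hα
  boundHD75Phi_srwTrueAlt_zero_le_on (by norm_num) (by linarith) hᾱ ha C hE0 hE0' hN1 hN2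
    (srwTS_le_tQDX4_on hC hα (by norm_num) (by norm_num) (by omega)) (srwTS_le_tQDX4_on hC hα (by norm_num) (by norm_num) (by omega))
    (srwTS_le_tQDX4_on hC hα (by norm_num) (by norm_num) (by omega))
    (srwU_le_uQX_on hC (by norm_num) (by norm_num) (by omega)) (srwU_le_uQX_on hC (by norm_num) (by norm_num) (by omega))
    (srwK_le_kQX_on hC (by norm_num) (by norm_num) (by omega)) (srwK_le_kQX_on hC (by norm_num) (by norm_num) (by omega)) hnum

/-- **Cells `(1,l)` over a set `C ⊆ Q10`, `boundHD75Phi`, swapped direct `T` slot `tQDX4 α`** (`l ≤ 20`) — twin of `SlotD10Phi.f3cellD10D_one_on_le_phi`. [cite: FitznerVanDerHofstad2016NoBLE, §3.3.5 (3.87) p. 1079; §5.1 p. 1093; (3.58)–(3.64) p. 1076; §5.2 (5.9), (5.15) p. 1092] [cite: FitznerVanDerHofstad2017, §2.5] -/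
theorem f3cellD10DX4_one_on_le_phi {C : Set (Fin 10 → ℤ)} (hC : C ⊆ Q10) (hα : 1 ≤ α) (hᾱ : 1 ≤ afmax) {a : Args} (ha : a.WF)
    {IMc : ℤ → ℕ → ℝ} {l : ℕ} (hl : l ≤ 20) {b : ℝ}
    (hE1 : OnDomAlt 10 (α : ℝ) afmax C 1 l (IMc 1 l)) (hE0 : OnDomAlt 10 (α : ℝ) afmax C 0 l (IMc 0 l))
    (hE1' : OnDomAlt 10 (α : ℝ) afmax C 1 (l + 1) (IMc 1 (l + 1))) (hE0' : OnDomAlt 10 (α : ℝ) afmax C 0 (l + 1) (IMc 0 (l + 1)))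
    (hE1'' : OnDomAlt 10 (α : ℝ) afmax C 1 (l + 2) (IMc 1 (l + 2)))
    (hnum : boundHD75Phi (Tables.cell IMc (tQDX4 α) uQX kQX : Tables (Fin 10 → ℤ)) 1 l 0 a ≤ b) :
    ∀ x ∈ C, boundHD75Phi (srwTrueAlt 10 (α : ℝ) afmax) 1 l x a ≤ b :=
  have hαR : (1 : ℝ) ≤ (α : ℝ) := by exact_mod_cast hα
  boundHD75Phi_srwTrueAlt_one_le_on (by norm_num) (by linarith) hᾱ ha C hE1 hE0 hE1' hE0' hE1''
    (srwTS_le_tQDX4_on hC hα (by norm_num) (by norm_num) (by omega)) (srwTS_le_tQDX4_on hC hα (by norm_num) (by norm_num) (by omega))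
    (srwTS_le_tQDX4_on hC hα (by norm_num) (by norm_num) (by omega))
    (srwU_le_uQX_on hC (by norm_num) (by norm_num) (by omega)) (srwU_le_uQX_on hC (by norm_num) (by norm_num) (by omega))
    (srwK_le_kQX_on hC (by norm_num) (by norm_num) (by omega)) (srwK_le_kQX_on hC (by norm_num) (by norm_num) (by omega)) hnum

end Wired

/-- **Closing rule, swapped direct `T` slot over `𝒳`** — twin of `SlotD10Phi.boundHD75Phi_cellXD_le_of_ratLe`. [cite: FitznerVanDerHofstad2016NoBLE, §3.3.5 (3.87) p. 1079; (3.58)–(3.64) p. 1076; §5.2 (5.9), (5.15) p. 1092] [cite: FitznerVanDerHofstad2017, §2.5] -/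
theorem boundHD75Phi_cellXDX4_le_of_ratLe (IMq : ℤ → ℕ → ℚ) {α : ℚ} {n l : ℕ} {aq : ArgsQ} {bq : ℚ}
    (h : boundHD75PhiQ IMq (tXDQX4 α) uS2X kS2X n l aq ≤ bq) :
    boundHD75Phi (Tables.cell (fun m l => ((IMq m l : ℚ) : ℝ)) (tXDX4 α) uXX kXX : Tables (Fin 10 → ℤ)) n l 0 aq.toArgs
      ≤ ((bq : ℚ) : ℝ) :=
  boundHD75Phi_cell_le_of_ratLe IMq (tXDQX4 α) uS2X kS2X 0 h

/-- **Closing rule, swapped direct `T` slot over `Q10` / the cones** — twin of `SlotD10Phi.boundHD75Phi_cellQD_le_of_ratLe`. [cite: FitznerVanDerHofstad2016NoBLE, §3.3.5 (3.87) p. 1079; §5.1 p. 1093; (3.58)–(3.64) p. 1076; §5.2 (5.9), (5.15) p. 1092] [cite: FitznerVanDerHofstad2017, §2.5] -/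
theorem boundHD75Phi_cellQDX4_le_of_ratLe (IMq : ℤ → ℕ → ℚ) {α : ℚ} {n l : ℕ} {aq : ArgsQ} {bq : ℚ}
    (h : boundHD75PhiQ IMq (tQDQX4 α) uS3X kS3X n l aq ≤ bq) :
    boundHD75Phi (Tables.cell (fun m l => ((IMq m l : ℚ) : ℝ)) (tQDX4 α) uQX kQX : Tables (Fin 10 → ℤ)) n l 0 aq.toArgs
      ≤ ((bq : ℚ) : ℝ) :=
  boundHD75Phi_cell_le_of_ratLe IMq (tQDQX4 α) uS3X kS3X 0 h

/-! ### §4  The six region slot theorems re-wired: decidable hypotheses only, conclusions verbatim those of `KUSepD10` / `SlotD10Phi` -/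

section Slot

variable {α amax bq : ℚ} {aq : ArgsQ} {IMq : ℤ → ℕ → ℚ} {l : ℕ}

/-- **`𝒳`-cell `(0,l)`, `boundHD75Phi`, swapped tables, all hypotheses decidable** — twin of `SlotD10Phi.slotXD_zero_le_phi` with `hnum` over
`tXDQX4`, `uS2X`, `kS2X`. [cite: FitznerVanDerHofstad2016NoBLE, §3.3.5 (3.87) p. 1079; (3.58)–(3.64) p. 1076; §5.2 (5.9), (5.15) p. 1092] [cite: FitznerVanDerHofstad2017, §2.5] -/
theorem slotXDX4_zero_le_phi (hα : 1 ≤ α) (hᾱ : 1 ≤ amax) (hwf : aq.wfCheck = true) (hl : l ≤ 20)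
    (hE0 : cellChk α amax 0 l (IMq 0 l) = true) (hE0' : cellChk α amax 0 (l + 1) (IMq 0 (l + 1)) = true)
    (hN1 : negOneFstChk α l (IMq (-1) l) = true) (hN2 : negOneSndChk α l (IMq (-1) l) = true)
    (hnum : boundHD75PhiQ IMq (tXDQX4 α) uS2X kS2X 0 l aq ≤ bq) :
    ∀ x ∈ calX 10, boundHD75Phi (srwTrueAlt 10 (α : ℝ) (amax : ℝ)) 0 l x aq.toArgs ≤ ((bq : ℚ) : ℝ) :=
  have hα0 : 0 < α := by linarith
  f3cellD10DX4_zero_calX_le_phi hα (by exact_mod_cast hᾱ) (ArgsQ.toArgs_WF hwf)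
    (IMc := fun m l => ((IMq m l : ℚ) : ℝ)) hl
    (cellDomAlt_of_chk hα0 hᾱ hE0) (cellDomAlt_of_chk hα0 hᾱ hE0') (negOne_fst_of_chk hα0 hN1) (negOne_snd_of_chk hN2)
    (boundHD75Phi_cellXDX4_le_of_ratLe IMq hnum)

/-- **`𝒳`-cells `(1,l)`, `boundHD75Phi`, swapped tables, all hypotheses decidable** — twin of `SlotD10Phi.slotXD_one_le_phi`. [cite: FitznerVanDerHofstad2016NoBLE, §3.3.5 (3.87) p. 1079; (3.58)–(3.64) p. 1076; §5.2 (5.9), (5.15) p. 1092] [cite: FitznerVanDerHofstad2017, §2.5] -/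
theorem slotXDX4_one_le_phi (hα : 1 ≤ α) (hᾱ : 1 ≤ amax) (hwf : aq.wfCheck = true) (hl : l ≤ 20)
    (hE1 : cellChk α amax 1 l (IMq 1 l) = true) (hE0 : cellChk α amax 0 l (IMq 0 l) = true)
    (hE1' : cellChk α amax 1 (l + 1) (IMq 1 (l + 1)) = true) (hE0' : cellChk α amax 0 (l + 1) (IMq 0 (l + 1)) = true)
    (hE1'' : cellChk α amax 1 (l + 2) (IMq 1 (l + 2)) = true)
    (hnum : boundHD75PhiQ IMq (tXDQX4 α) uS2X kS2X 1 l aq ≤ bq) :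
    ∀ x ∈ calX 10, boundHD75Phi (srwTrueAlt 10 (α : ℝ) (amax : ℝ)) 1 l x aq.toArgs ≤ ((bq : ℚ) : ℝ) :=
  have hα0 : 0 < α := by linarith
  f3cellD10DX4_one_calX_le_phi hα (by exact_mod_cast hᾱ) (ArgsQ.toArgs_WF hwf)
    (IMc := fun m l => ((IMq m l : ℚ) : ℝ)) hl
    (cellDomAlt_of_chk hα0 hᾱ hE1) (cellDomAlt_of_chk hα0 hᾱ hE0) (cellDomAlt_of_chk hα0 hᾱ hE1')
    (cellDomAlt_of_chk hα0 hᾱ hE0') (cellDomAlt_of_chk hα0 hᾱ hE1'')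
    (boundHD75Phi_cellXDX4_le_of_ratLe IMq hnum)

/-- **Cone cell `(0,l)` on `Cn.cone v`, `boundHD75Phi`, swapped tables, all hypotheses decidable** — twin of `SlotD10Phi.slotConeD_zero_le_phi`
with `hnum` over `tQDQX4`, `uS3X`, `kS3X`. [cite: FitznerVanDerHofstad2016NoBLE, §3.3.5 (3.87) p. 1079; §5.1 p. 1093; (3.58)–(3.64) p. 1076; §5.2 (5.9), (5.15) p. 1092] [cite: FitznerVanDerHofstad2017, §2.5] -/
theorem slotConeDX4_zero_le_phi (v : Cn) (hα : 1 ≤ α) (hᾱ : 1 ≤ amax) (hwf : aq.wfCheck = true) (hl : l ≤ 20)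
    (hE0 : coneChk v α amax 0 l (IMq 0 l) = true) (hE0' : coneChk v α amax 0 (l + 1) (IMq 0 (l + 1)) = true)
    (hN1 : coneNegOneFstChk v α l (IMq (-1) l) = true) (hN2 : coneNegOneSndChk v α l (IMq (-1) l) = true)
    (hnum : boundHD75PhiQ IMq (tQDQX4 α) uS3X kS3X 0 l aq ≤ bq) :
    ∀ x ∈ v.cone, boundHD75Phi (srwTrueAlt 10 (α : ℝ) (amax : ℝ)) 0 l x aq.toArgs ≤ ((bq : ℚ) : ℝ) :=
  have hα0 : 0 < α := by linarith
  f3cellD10DX4_zero_on_le_phi v.cone_subset_Q10 hα (by exact_mod_cast hᾱ) (ArgsQ.toArgs_WF hwf)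
    (IMc := fun m l => ((IMq m l : ℚ) : ℝ)) hl
    (onDomAlt_of_chk v hᾱ hE0) (onDomAlt_of_chk v hᾱ hE0') (coneNegOne_fst_of_chk v hα0 hN1) (coneNegOne_snd_of_chk v hN2)
    (boundHD75Phi_cellQDX4_le_of_ratLe IMq hnum)

/-- **Cone cells `(1,l)` on `Cn.cone v`, `boundHD75Phi`, swapped tables, all hypotheses decidable** — twin of `SlotD10Phi.slotConeD_one_le_phi`. [cite: FitznerVanDerHofstad2016NoBLE, §3.3.5 (3.87) p. 1079; §5.1 p. 1093; (3.58)–(3.64) p. 1076; §5.2 (5.9), (5.15) p. 1092] [cite: FitznerVanDerHofstad2017, §2.5] -/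
theorem slotConeDX4_one_le_phi (v : Cn) (hα : 1 ≤ α) (hᾱ : 1 ≤ amax) (hwf : aq.wfCheck = true) (hl : l ≤ 20)
    (hE1 : coneChk v α amax 1 l (IMq 1 l) = true) (hE0 : coneChk v α amax 0 l (IMq 0 l) = true)
    (hE1' : coneChk v α amax 1 (l + 1) (IMq 1 (l + 1)) = true) (hE0' : coneChk v α amax 0 (l + 1) (IMq 0 (l + 1)) = true)
    (hE1'' : coneChk v α amax 1 (l + 2) (IMq 1 (l + 2)) = true)
    (hnum : boundHD75PhiQ IMq (tQDQX4 α) uS3X kS3X 1 l aq ≤ bq) :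
    ∀ x ∈ v.cone, boundHD75Phi (srwTrueAlt 10 (α : ℝ) (amax : ℝ)) 1 l x aq.toArgs ≤ ((bq : ℚ) : ℝ) :=
  f3cellD10DX4_one_on_le_phi v.cone_subset_Q10 hα (by exact_mod_cast hᾱ) (ArgsQ.toArgs_WF hwf)
    (IMc := fun m l => ((IMq m l : ℚ) : ℝ)) hl
    (onDomAlt_of_chk v hᾱ hE1) (onDomAlt_of_chk v hᾱ hE0) (onDomAlt_of_chk v hᾱ hE1') (onDomAlt_of_chk v hᾱ hE0')
    (onDomAlt_of_chk v hᾱ hE1'')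
    (boundHD75Phi_cellQDX4_le_of_ratLe IMq hnum)

variable {IM3 IM21 IM111 : ℤ → ℕ → ℚ}

/-- **Cell `(0,l)` on all of `Q`, `boundHD75Phi`, swapped tables**, all hypotheses decidable: the three `slotConeDX4_zero_le_phi v` glued — twin of
`SlotD10Phi.slotQD_zero_le_phi`. [cite: FitznerVanDerHofstad2016NoBLE, §3.3.5 (3.87) p. 1079; §5.1 p. 1093; (3.58)–(3.64) p. 1076; §5.2 (5.9), (5.15) p. 1092] [cite: FitznerVanDerHofstad2017, §2.5] -/
theorem slotQDX4_zero_le_phi (hα : 1 ≤ α) (hᾱ : 1 ≤ amax) (hwf : aq.wfCheck = true) (hl : l ≤ 20)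
    (h3E0 : coneChk .v3 α amax 0 l (IM3 0 l) = true) (h3E0' : coneChk .v3 α amax 0 (l + 1) (IM3 0 (l + 1)) = true)
    (h3N1 : coneNegOneFstChk .v3 α l (IM3 (-1) l) = true) (h3N2 : coneNegOneSndChk .v3 α l (IM3 (-1) l) = true)
    (h3num : boundHD75PhiQ IM3 (tQDQX4 α) uS3X kS3X 0 l aq ≤ bq)
    (h21E0 : coneChk .v21 α amax 0 l (IM21 0 l) = true) (h21E0' : coneChk .v21 α amax 0 (l + 1) (IM21 0 (l + 1)) = true)
    (h21N1 : coneNegOneFstChk .v21 α l (IM21 (-1) l) = true) (h21N2 : coneNegOneSndChk .v21 α l (IM21 (-1) l) = true)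
    (h21num : boundHD75PhiQ IM21 (tQDQX4 α) uS3X kS3X 0 l aq ≤ bq)
    (h111E0 : coneChk .v111 α amax 0 l (IM111 0 l) = true) (h111E0' : coneChk .v111 α amax 0 (l + 1) (IM111 0 (l + 1)) = true)
    (h111N1 : coneNegOneFstChk .v111 α l (IM111 (-1) l) = true) (h111N2 : coneNegOneSndChk .v111 α l (IM111 (-1) l) = true)
    (h111num : boundHD75PhiQ IM111 (tQDQX4 α) uS3X kS3X 0 l aq ≤ bq) :
    ∀ x : Fin 10 → ℤ, 3 ≤ ∑ j, |x j| → boundHD75Phi (srwTrueAlt 10 (α : ℝ) (amax : ℝ)) 0 l x aq.toArgs ≤ ((bq : ℚ) : ℝ) :=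
  boundHD75Phi_Q_le_of_cones
    (slotConeDX4_zero_le_phi .v3 hα hᾱ hwf hl h3E0 h3E0' h3N1 h3N2 h3num)
    (slotConeDX4_zero_le_phi .v21 hα hᾱ hwf hl h21E0 h21E0' h21N1 h21N2 h21num)
    (slotConeDX4_zero_le_phi .v111 hα hᾱ hwf hl h111E0 h111E0' h111N1 h111N2 h111num)

/-- **Cell `(1,l)` on all of `Q`, `boundHD75Phi`, swapped tables**, all hypotheses decidable: the three `slotConeDX4_one_le_phi v` glued — twin of
`SlotD10Phi.slotQD_one_le_phi`. [cite: FitznerVanDerHofstad2016NoBLE, §3.3.5 (3.87) p. 1079; §5.1 p. 1093; (3.58)–(3.64) p. 1076; §5.2 (5.9), (5.15) p. 1092] [cite: FitznerVanDerHofstad2017, §2.5] -/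
theorem slotQDX4_one_le_phi (hα : 1 ≤ α) (hᾱ : 1 ≤ amax) (hwf : aq.wfCheck = true) (hl : l ≤ 20)
    (h3E1 : coneChk .v3 α amax 1 l (IM3 1 l) = true) (h3E0 : coneChk .v3 α amax 0 l (IM3 0 l) = true)
    (h3E1' : coneChk .v3 α amax 1 (l + 1) (IM3 1 (l + 1)) = true) (h3E0' : coneChk .v3 α amax 0 (l + 1) (IM3 0 (l + 1)) = true)
    (h3E1'' : coneChk .v3 α amax 1 (l + 2) (IM3 1 (l + 2)) = true)
    (h3num : boundHD75PhiQ IM3 (tQDQX4 α) uS3X kS3X 1 l aq ≤ bq)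
    (h21E1 : coneChk .v21 α amax 1 l (IM21 1 l) = true) (h21E0 : coneChk .v21 α amax 0 l (IM21 0 l) = true)
    (h21E1' : coneChk .v21 α amax 1 (l + 1) (IM21 1 (l + 1)) = true) (h21E0' : coneChk .v21 α amax 0 (l + 1) (IM21 0 (l + 1)) = true)
    (h21E1'' : coneChk .v21 α amax 1 (l + 2) (IM21 1 (l + 2)) = true)
    (h21num : boundHD75PhiQ IM21 (tQDQX4 α) uS3X kS3X 1 l aq ≤ bq)
    (h111E1 : coneChk .v111 α amax 1 l (IM111 1 l) = true) (h111E0 : coneChk .v111 α amax 0 l (IM111 0 l) = true)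
    (h111E1' : coneChk .v111 α amax 1 (l + 1) (IM111 1 (l + 1)) = true)
    (h111E0' : coneChk .v111 α amax 0 (l + 1) (IM111 0 (l + 1)) = true)
    (h111E1'' : coneChk .v111 α amax 1 (l + 2) (IM111 1 (l + 2)) = true)
    (h111num : boundHD75PhiQ IM111 (tQDQX4 α) uS3X kS3X 1 l aq ≤ bq) :
    ∀ x : Fin 10 → ℤ, 3 ≤ ∑ j, |x j| → boundHD75Phi (srwTrueAlt 10 (α : ℝ) (amax : ℝ)) 1 l x aq.toArgs ≤ ((bq : ℚ) : ℝ) :=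
  boundHD75Phi_Q_le_of_cones
    (slotConeDX4_one_le_phi .v3 hα hᾱ hwf hl h3E1 h3E0 h3E1' h3E0' h3E1'' h3num)
    (slotConeDX4_one_le_phi .v21 hα hᾱ hwf hl h21E1 h21E0 h21E1' h21E0' h21E1'' h21num)
    (slotConeDX4_one_le_phi .v111 hα hᾱ hwf hl h111E1 h111E0 h111E1' h111E0' h111E1'' h111num)

end Slot

end KUSepD10R4

end Literature.Probability.FitznerVanDerHofstad2017

end
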